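import Summits.KontsevichZagierPeriods.KontsevichZagierPeriods.Theses.HodgeColevel
import Summits.KontsevichZagierPeriods.KontsevichZagierPeriods.Theorems.HodgeColevelCoresOfSummit
import Summits.KontsevichZagierPeriods.KontsevichZagierPeriods.Theorems.LowDimensionLowdimBaker0DimLeOne
import Summits.KontsevichZagierPeriods.KontsevichZagierPeriods.Theorems.AbelContractionAreasToArcs
import Literature.NumberTheory.Transcendental.KZKernelConjectureForms
import Literature.NumberTheory.Transcendental.KZDegree

/-!
# Census sketch — crux `DegreeCompression` (stmt-KontsevichZagierPeriods-6177, route HodgeColevel, rank 4)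

Crux-strategist seat `cstrat-stmt-KontsevichZagierPeriods-6177-s2`, 2026-08-17. Companion to
`Cruxes/DegreeCompression/STRATEGY-CENSUS.md`: every typed statement quoted in the census is
elaborated here, and every implication the census calls "proved" is proved here (no `sorry`).

Contents.
* §1 The four typable STRENGTHENINGS of the crux in the language of the calculus of moves —
  `Access` (line `birth`'s transfer, all target dimensions merged), `AccessSA` (the same for all
  semialgebraic representations), `OneStep` (the codimension-one ladder), `ValueDeterminesDegree`
  (`KZ.degree` factors through `value`) — and the proof that ALL FOUR ARE EQUIVALENT TO THE CRUX
  (`degreeCompression_iff_access`, `access_iff_accessSA`, `accessSA_iff_oneStep`,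
  `accessSA_iff_valueDeterminesDegree`). Inputs: the rational lift
  `KZ.exists_isRational_equivalent_holds` (Tarski–Seidenberg, landed), the up-set lemma
  `KZ.IntegralRep.exists_equivalent_of_le` (slabs, landed), soundness `KZ.Equivalent.value_eq_holds`,
  and the `KZ.degree` API. Consequence for the census: no strengthening in this language adds
  rigidity — each IS the crux.
* §2 Consistency: the summit gives all of them (`accessSA_of_summit`).
* §3 The dimension-`≤ 1` rational sector of the crux is PROVED in tree (`degreeCompression_dimLEOne`,
  from `LowdimBaker0DimLeOne`, item 10622, Baker), and the semialgebraic rung `j = 0` of the ladder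
  follows from the open SHARED item `PlanarAreas` (4990, Huber–Wüstholz transferred) by the landed
  transfer 0117 (`oneStep_zero_of_planarAreas`) — the whole 1-motive sector is owned elsewhere.
* §4 The shape of every cell above it: `reachable_zero_of_rat_value` / `reachable_of_value_eq` —
  under the crux a rational representation moves to a point as soon as its value is a rational
  NUMBER, and into `k` variables as soon as its value is the value of any `k`-dimensional
  representation; with the route's own separator `MZVWeightDegree` (item 6176) this yields the
  irrationality of every multiple zeta value (`irrational_mzv_of_degreeCompression`, e.g. `ζ(5) ∉ ℚ`),
  the named open statement that calibrates "summit-hard" for the census.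
* §5 Negation is void by theorem: a counterexample to the crux refutes Conjecture 1
  (`not_summit_of_not_degreeCompression`, from the landed `CoresOfSummit`).
-/

set_option linter.dupNamespace false

noncomputable section

namespace Summit.KontsevichZagierPeriods.KontsevichZagierPeriods.Cruxes.DegreeCompression.Census

open MeasureTheory Set
open Literature.NumberTheory.Transcendental
open Summit.KontsevichZagierPeriods.KontsevichZagierPeriods.Theses.HodgeColevel
  (DegreeCompression MZVWeightDegree)

/-! ## §1 Strengthenings, typed — and all equivalent to the crux -/

/-- `Access` (line `birth`, all `k` merged): a KZ-rational representation can be moved into every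
dimension `k` in which its value is representable at all. -/
def Access : Prop :=
  ∀ (k n : ℕ) (r : KZ.IntegralRep n), r.IsRational →
    (∃ u : KZ.IntegralRep k, u.value = r.value) → KZ.Reachable r k

/-- `AccessSA`: the same for ALL (ℚ-semialgebraic) representations `r`. -/
def AccessSA : Prop :=
  ∀ (k n : ℕ) (r : KZ.IntegralRep n) (u : KZ.IntegralRep k), r.value = u.value → KZ.Reachable r k

/-- `OneStep` (codimension-one ladder): a `(j+1)`-dimensional representation whose value is the value
of some `j`-dimensional representation loses one variable by moves. -/
def OneStep : Prop :=
  ∀ (j : ℕ) (r : KZ.IntegralRep (j + 1)) (u : KZ.IntegralRep j), r.value = u.value → KZ.Reachable r j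

/-- `ValueDeterminesDegree`: the KZ-degree (least reachable dimension, `KZ.degree`) of a
representation depends only on its value — "the move-degree IS Wan's value-degree". -/
def ValueDeterminesDegree : Prop :=
  ∀ (n m : ℕ) (r : KZ.IntegralRep n) (u : KZ.IntegralRep m), r.value = u.value →
    KZ.degree r = KZ.degree u

/-- `Access → DegreeCompression` (line `birth`'s composition, all layers at once). -/
theorem degreeCompression_of_access (h : Access) : DegreeCompression := by
  intro n m r r' _ hr' hv k hk
  obtain ⟨s, hs⟩ := hk
  exact h k m r' hr' ⟨s, ((KZ.Equivalent.value_eq_holds hs).symm).trans hv⟩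

/-- `DegreeCompression → Access`: the converse, by the RATIONAL LIFT — the witness `u` of dimension
`k` is KZ-equivalent to a rational representation `R` (of some dimension), `R` reaches `k` through `u`,
and the crux transports reachability from `R` to `r`. So `birth`'s transfer is an EQUIVALENCE. -/
theorem access_of_degreeCompression (h : DegreeCompression) : Access := by
  intro k n r hr hu
  obtain ⟨u, hu⟩ := hu
  obtain ⟨N, R, hR, huR⟩ := KZ.exists_isRational_equivalent_holds u
  have hv : R.value = r.value := ((KZ.Equivalent.value_eq_holds huR).symm).trans hu
  exact h R r hR hr hv k ⟨u, huR.symm⟩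

theorem degreeCompression_iff_access : DegreeCompression ↔ Access :=
  ⟨access_of_degreeCompression, degreeCompression_of_access⟩

/-- `Access → AccessSA`: rational lift of `r` itself. -/
theorem accessSA_of_access (h : Access) : AccessSA := by
  intro k n r u hv
  obtain ⟨N, R, hR, hrR⟩ := KZ.exists_isRational_equivalent_holds r
  have hRv : u.value = R.value := hv.symm.trans (KZ.Equivalent.value_eq_holds hrR)
  obtain ⟨s, hs⟩ := h k N R hR ⟨u, hRv⟩
  exact ⟨s, hrR.trans hs⟩

theorem access_of_accessSA (h : AccessSA) : Access := by
  intro k n r _ hu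
  obtain ⟨u, hu⟩ := hu
  exact h k n r u hu.symm

theorem access_iff_accessSA : Access ↔ AccessSA :=
  ⟨accessSA_of_access, access_of_accessSA⟩

theorem oneStep_of_accessSA (h : AccessSA) : OneStep :=
  fun j r u hv => h j (j + 1) r u hv

/-- `OneStep → AccessSA`: descending induction on the codimension `n − k`, peeling one variable at a
time; target dimensions `k ≥ n` are free (the reachable dimensions are an up-set, slabs). -/
theorem accessSA_of_oneStep (h : OneStep) : AccessSA := by
  have key : ∀ (d k : ℕ) (r : KZ.IntegralRep (k + d)) (u : KZ.IntegralRep k),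
      r.value = u.value → KZ.Reachable r k := by
    intro d
    induction d with
    | zero =>
      intro k r u _
      exact KZ.reachable_self r
    | succ d ih =>
      intro k r u hv
      obtain ⟨U, hU⟩ := u.exists_equivalent_of_le (Nat.le_add_right k d)
      have hUv : r.value = U.value := hv.trans (KZ.Equivalent.value_eq_holds hU)
      obtain ⟨s, hs⟩ := h (k + d) r U hUv
      have hsv : s.value = u.value := ((KZ.Equivalent.value_eq_holds hs).symm).trans hv
      obtain ⟨t, ht⟩ := ih k s u hsv
      exact ⟨t, hs.trans ht⟩
  intro k n r u hv
  rcases le_total n k with hnk | hkn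
  · obtain ⟨R, hR⟩ := r.exists_equivalent_of_le hnk
    exact ⟨R, hR⟩
  · obtain ⟨d, rfl⟩ : ∃ d, n = k + d := ⟨n - k, by omega⟩
    exact key d k r u hv

theorem accessSA_iff_oneStep : AccessSA ↔ OneStep :=
  ⟨oneStep_of_accessSA, accessSA_of_oneStep⟩

theorem valueDeterminesDegree_of_accessSA (h : AccessSA) : ValueDeterminesDegree := by
  intro n m r u hv
  apply le_antisymm
  · obtain ⟨t, ht⟩ := KZ.degree_spec u
    have htv : r.value = t.value := hv.trans (KZ.Equivalent.value_eq_holds ht)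
    exact KZ.degree_le_of_reachable (h _ _ r t htv)
  · obtain ⟨t, ht⟩ := KZ.degree_spec r
    have htv : u.value = t.value := hv.symm.trans (KZ.Equivalent.value_eq_holds ht)
    exact KZ.degree_le_of_reachable (h _ _ u t htv)

theorem accessSA_of_valueDeterminesDegree (h : ValueDeterminesDegree) : AccessSA := by
  intro k n r u hv
  obtain ⟨t, ht⟩ := KZ.degree_spec r
  have hle : KZ.degree r ≤ k := (h n k r u hv).trans_le (KZ.degree_le u)
  obtain ⟨T, hT⟩ := t.exists_equivalent_of_le hle
  exact ⟨T, ht.trans hT⟩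

theorem accessSA_iff_valueDeterminesDegree : AccessSA ↔ ValueDeterminesDegree :=
  ⟨valueDeterminesDegree_of_accessSA, accessSA_of_valueDeterminesDegree⟩

/-- Summary: the crux, in its sharpest move-language form. -/
theorem degreeCompression_iff_valueDeterminesDegree : DegreeCompression ↔ ValueDeterminesDegree :=
  degreeCompression_iff_access.trans
    (access_iff_accessSA.trans accessSA_iff_valueDeterminesDegree)

/-! ## §2 Consistency: the summit gives every form -/

theorem accessSA_of_kzPeriodConjecture' (H : KZPeriodConjecture') : AccessSA :=
  fun _ _ r u hv => ⟨u, H r u hv⟩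

theorem accessSA_of_summit (H : _root_.KontsevichZagierPeriods) : AccessSA :=
  accessSA_of_kzPeriodConjecture' (kzPeriodConjecture'_iff_isRational.mpr H)

/-! ## §3 The dimension-`≤ 1` rational sector is a theorem (item 10622, Baker) -/

/-- The crux restricted to source dimensions `n, m ≤ 1` (all target dimensions `k`) is PROVED:
`LowdimBaker0DimLeOne` makes the two rational representations KZ-equivalent outright. -/
theorem degreeCompression_dimLEOne :
    ∀ ⦃n m : ℕ⦄, n ≤ 1 → m ≤ 1 → ∀ (r : KZ.IntegralRep n) (r' : KZ.IntegralRep m),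
      r.IsRational → r'.IsRational → r.value = r'.value →
        ∀ k : ℕ, KZ.Reachable r k → KZ.Reachable r' k := by
  intro n m hn hm r r' hr hr' hv k hk
  obtain ⟨s, hs⟩ := hk
  exact ⟨s, (Summit.KontsevichZagierPeriods.LowDimension.LowdimBaker0DimLeOne.lowdimBaker0DimLeOne_proof
    hn hm r r' hr hr' hv).symm.trans hs⟩

/-- Rung `j = 0` of the codimension ladder — a 1-dimensional representation whose value is the value of
a point moves to a point — follows from the open shared item `PlanarAreas` (stmt-4990, routes
LowDimension / HodgeLevel / AbelContraction: Huber–Wüstholz's theorem transferred into moves) by the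
LANDED transfer `LowdimHuberWustholzTransfer` (stmt-0117). So the ladder's only theorem-level rung is
staffed elsewhere. -/
theorem oneStep_zero_of_planarAreas
    (hP : Summit.KontsevichZagierPeriods.KontsevichZagierPeriods.Theses.LowDimension.PlanarAreas) :
    ∀ (r : KZ.IntegralRep 1) (u : KZ.IntegralRep 0), r.value = u.value → KZ.Reachable r 0 := by
  intro r u hv
  obtain ⟨U, hU⟩ := u.exists_equivalent_of_le (Nat.zero_le 1)
  have h := Summit.KontsevichZagierPeriods.AbelContraction.AreasToArcs.lowdimHuberWustholzTransfer_proof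
    hP r U (hv.trans (KZ.Equivalent.value_eq_holds hU))
  exact ⟨u, h.trans hU.symm⟩

/-! ## §4 The shape of every higher cell, and the MZV calibration of "summit-hard" -/

/-- The rational constant `q` in dimension `0`: `[ℝ⁰, q]` (local copy of the tree's `constRep`). -/
def constRep (q : ℚ) : KZ.IntegralRep 0 :=
  KZ.IntegralRep.ofRational univ (MvPolynomial.C q) 1
    Literature.ModelTheory.ExponentialFields.isSemialgebraic_univ (fun _ _ => by simp) (by simp)

theorem constRep_isRational (q : ℚ) : (constRep q).IsRational :=
  KZ.IntegralRep.isRational_ofRational _ _ _ _ _ _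

theorem volume_univ_fin_zero : volume (univ : Set (Fin 0 → ℝ)) = 1 := by
  rw [volume_pi, Measure.pi_univ]
  simp

@[simp] theorem constRep_value (q : ℚ) : (constRep q).value = q := by
  simp only [constRep, KZ.IntegralRep.value_ofRational]
  simp [Measure.real, volume_univ_fin_zero]

/-- Cell shape, `k = 0`: under the crux, a KZ-rational representation whose value is a rational
NUMBER moves to a point. (Instance to keep in mind: Catalan's `G = ∫∫_{(0,1)²} dx dy/(1+x²y²)`; a
proof of this cell must produce the chain from the bare hypothesis `G = q`.) -/
theorem reachable_zero_of_rat_value (hC : DegreeCompression) {n : ℕ} (r : KZ.IntegralRep n)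
    (hr : r.IsRational) (q : ℚ) (hq : r.value = q) : KZ.Reachable r 0 :=
  hC (constRep q) r (constRep_isRational q) hr (by rw [constRep_value, hq]) 0
    ⟨constRep q, KZ.Equivalent.refl _⟩

/-- Cell shape, general `k`: under the crux, a KZ-rational representation moves into `k` variables
as soon as its value is the value of ANY `k`-dimensional representation (= `Access`). -/
theorem reachable_of_value_eq (hC : DegreeCompression) {n k : ℕ} (r : KZ.IntegralRep n)
    (hr : r.IsRational) (u : KZ.IntegralRep k) (hu : u.value = r.value) : KZ.Reachable r k :=
  access_of_degreeCompression hC k n r hr ⟨u, hu⟩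

/-- The simplex representation of a multiple zeta value has KZ's literal (rational) shape. -/
theorem isRational_mzvRep (s : List ℕ) (hs : MZV.IsAdmissible s) (h₁) (h₂) :
    (KZ.mzvRep s hs h₁ h₂).IsRational :=
  ⟨1, _, fun _ ht => KZ.aeval_prod_ne_zero_of_mem_openOrderedSimplex s ht,
    fun t _ => KZ.mzvIntegrand_eq_aeval_div_aeval s t⟩

/-- **MZV calibration of "summit-hard".** The crux together with the route's own separator
`MZVWeightDegree` (item 6176: the weight-`w` simplex is not KZ-equivalent to anything of dimension
`< w`) proves that EVERY multiple zeta value of positive weight is irrational — e.g. `ζ(5) ∉ ℚ`,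
open (only "one of ζ(5), …, ζ(11) is irrational" is known). -/
theorem irrational_mzv_of_degreeCompression (hC : DegreeCompression) (hW : MZVWeightDegree)
    (s : List ℕ) (hs : MZV.IsAdmissible s) (hw : 1 ≤ MZV.weight s) :
    Irrational (KZ.mzvRep s hs (KZ.mzvIntegrand_isSemialgebraicFunOn_holds s)
      (KZ.mzvIntegrand_integrableOn_holds s hs)).value := by
  rintro ⟨q, hq⟩
  obtain ⟨s', hs'⟩ := reachable_zero_of_rat_value hC _ (isRational_mzvRep s hs _ _) q hq.symm
  exact hW s hs 0 (by omega) s' hs'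

/-! ## §5 Negation is void by theorem -/

/-- A counterexample to the crux is a counterexample to Conjecture 1 (`CoresOfSummit`, landed). -/
theorem not_summit_of_not_degreeCompression (h : ¬ DegreeCompression) :
    ¬ _root_.KontsevichZagierPeriods :=
  fun H => h (Summit.KontsevichZagierPeriods.HodgeColevel.coresOfSummit_proof H).1

end Summit.KontsevichZagierPeriods.KontsevichZagierPeriods.Cruxes.DegreeCompression.Census

end
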